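import Summits.AnomalousDissipation.AnomalousDissipation.Theorems.TwohalfdNeg.Negative.LaminarShear
import Literature.Barriers.AnomalousDissipation.GravestModeLaminarAttractorSwept

/-!
# Negative knowledge for the crux `TwohalfdNeg` (stmt-AnomalousDissipation-0211), V: no fixed-time version —
# free decay of level-dependent data under the ZERO force

Certified copy of §8 of the cdisprove work file `Cruxes/TwohalfdNeg/Disproof.lean` (cycle 2).  The crux concludes
that the LONG-TIME MEAN dissipation tends to `0`; the natural strengthening to a fixed positive time,
`∀ t > 0, ν_j‖∇u_j(t)‖² → 0` (`TwohalfdNegPointwise`, hypotheses verbatim incl. the energy ceiling), is FALSE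
(`twohalfdNeg_false_pointwise`) — already for the zero force: `ν_j = (j+1)⁻²`, data `(0,0,cos(2π(j+1)x₀))`
(`L²`-bounded, living at the dissipative scale `|k| = ν_j^{-1/2}`), free decay `u_j(t) = e^{-4π²t}u₀_j`
(classical with zero force since `ν_j(j+1)² = 1`, hence global Leray–Hopf; `isGlobalLerayHopf_decay`): mean energy
`≤ 1/2`, mean dissipation `0`, but `ν_j‖∇u_j(t)‖² = 2π²e^{-8π²t}` for all `j`.  Reading: the time average is
essential and the initial-energy term `‖u₀_j‖²/T` must be carried by any windowed reduction.  Uses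
`Literature.Barriers.AnomalousDissipation.longTimeAvgSup_le_of_forall_le`.  Supports stmt-AnomalousDissipation-0211.
-/

noncomputable section

namespace Summit.AnomalousDissipation.AnomalousDissipation.Theorems.TwohalfdNeg.Negative

open MeasureTheory Set Filter Topology UnitAddTorus
open scoped ENNReal NNReal InnerProductSpace ComplexConjugate
open Literature.Analysis.FunctionSpaces Literature.Analysis.FunctionSpaces.Torus
open Literature.Analysis.FluidPDE Literature.Analysis.FluidPDE.Torus

/-! ## 8. Free decay: the pointwise-in-time strengthening is FALSE even for the zero force -/

section Decay

/-- The decay rate `4π²` (with `ν_j (j+1)² = 1` every level decays at the same rate). [folklore] -/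
def decayRate : ℝ := 4 * Real.pi ^ 2

/-- The freely decaying shear profile `R(t, y) = a e^{-4π² t} cos(2π(n+1)y₀)`. [folklore] -/
def decayProfile (n : ℕ) (a : ℝ) (t : ℝ) (y : (UnitAddTorus (Fin 2))) : ℝ := Real.exp (-decayRate * t) * profile n a y

/-- Time slices of the decaying profile are rescaled cosine profiles. [folklore] -/
theorem decayProfile_eq (n : ℕ) (a t : ℝ) : decayProfile n a t = profile n (Real.exp (-decayRate * t) * a) := by
  funext y
  rw [decayProfile, profile_mul]

/-- The freely decaying vertical shear `u(t) = (0, 0, a e^{-4π²t} cos(2π(n+1)x₀))`. [folklore] -/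
def decayState (n : ℕ) (a : ℝ) (t : ℝ) : (UnitAddTorus (Fin 3)) → (EuclideanSpace ℝ (Fin 3)) := twoHalf 0 (decayProfile n a t)

/-- Time slices of the decaying shear are shear states. [folklore] -/
theorem decayState_eq (n : ℕ) (a t : ℝ) : decayState n a t = shear n (Real.exp (-decayRate * t) * a) := by
  rw [decayState, decayProfile_eq, shear]

/-- The decaying profile is jointly smooth. [folklore] -/
theorem isSmoothSpaceTimeOn_decayProfile (n : ℕ) (a : ℝ) : IsSmoothSpaceTimeOn univ (decayProfile n a) := by
  have h1 : IsSmoothSpaceTimeOn univ (fun (t : ℝ) (_ : (UnitAddTorus (Fin 2))) => Real.exp (-decayRate * t)) := by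
    refine isSmoothSpaceTimeOn_of_contDiff ?_ _
    exact ((Real.contDiff_exp.comp (contDiff_const.mul contDiff_fst)) :
      ContDiff ℝ ((⊤ : ℕ∞) : WithTop ℕ∞) fun z : ℝ × (EuclideanSpace ℝ (Fin 2)) => Real.exp (-decayRate * z.1))
  exact h1.mul (isSmoothSpaceTimeOn_const (isSmooth_profile n a) _)

/-- `∂ₜ (a e^{-4π²t} cos) = -4π² a e^{-4π²t} cos`. [folklore] -/
theorem timeDerivWithin_decayProfile (n : ℕ) (a t : ℝ) (y : (UnitAddTorus (Fin 2))) :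
    Literature.Analysis.FunctionSpaces.Torus.timeDerivWithin univ (decayProfile n a) t y =
      -decayRate * decayProfile n a t y := by
  simp only [Literature.Analysis.FunctionSpaces.Torus.timeDerivWithin, derivWithin_univ, decayProfile]
  rw [deriv_mul_const (by fun_prop)]
  have h : deriv (fun τ : ℝ => Real.exp (-decayRate * τ)) t = -decayRate * Real.exp (-decayRate * t) := by
    rw [_root_.deriv_exp (by fun_prop), deriv_const_mul _ differentiableAt_id, deriv_id'']
    ring
  rw [h]
  ring

/-- **The residual force of the free decay vanishes** when `ν (n+1)² = 1`: `∂ₜR - νΔR = (-4π² + 4π²ν(n+1)²) R = 0`. [folklore] -/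
theorem twoHalfForce_decay (n : ℕ) {ν : ℝ} (hν : ν * ((n : ℝ) + 1) ^ 2 = 1) (a : ℝ) :
    twoHalfForce univ ν (fun _ => (0 : (UnitAddTorus (Fin 2)) → (EuclideanSpace ℝ (Fin 2)))) (decayProfile n a) (fun _ _ => (0 : ℝ)) = fun _ => (0 : (UnitAddTorus (Fin 3)) → (EuclideanSpace ℝ (Fin 3))) := by
  funext t x
  rw [twoHalfForce_apply]
  have h1 : (fun y => Literature.Analysis.FunctionSpaces.Torus.timeDerivWithin univ (fun _ : ℝ => (0 : (UnitAddTorus (Fin 2)) → (EuclideanSpace ℝ (Fin 2)))) t y +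
      Torus.convect ((fun _ : ℝ => (0 : (UnitAddTorus (Fin 2)) → (EuclideanSpace ℝ (Fin 2)))) t) ((fun _ : ℝ => (0 : (UnitAddTorus (Fin 2)) → (EuclideanSpace ℝ (Fin 2)))) t) y -
      ν • Torus.laplacian ((fun _ : ℝ => (0 : (UnitAddTorus (Fin 2)) → (EuclideanSpace ℝ (Fin 2)))) t) y +
      Torus.gradient ((fun _ _ => (0 : ℝ)) t) y) = (0 : (UnitAddTorus (Fin 2)) → (EuclideanSpace ℝ (Fin 2))) := by
    funext y
    simp only [timeDerivWithin_const_fun, convect_zero₂, laplacian_zero₂, gradient_zero₂, smul_zero]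
    simp
  have h2 : (fun y => Literature.Analysis.FunctionSpaces.Torus.timeDerivWithin univ (decayProfile n a) t y +
      ⟪((fun _ : ℝ => (0 : (UnitAddTorus (Fin 2)) → (EuclideanSpace ℝ (Fin 2)))) t) y, Torus.gradient (decayProfile n a t) y⟫_ℝ -
      ν * Torus.laplacian (decayProfile n a t) y) = (0 : (UnitAddTorus (Fin 2)) → ℝ) := by
    funext y
    rw [timeDerivWithin_decayProfile, decayProfile_eq, laplacian_profile]
    simp only [Pi.zero_apply, inner_zero_left, add_zero, decayRate]
    linear_combination (4 * Real.pi ^ 2 * profile n (Real.exp (-(4 * Real.pi ^ 2) * t) * a) y) * hν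
  rw [h1, h2, twoHalf_zero]

/-- **Free decay is a classical Navier–Stokes solution with ZERO force** (and zero pressure). [folklore] -/
theorem isClassicalNSSolutionOn_decay (n : ℕ) {ν : ℝ} (hν : ν * ((n : ℝ) + 1) ^ 2 = 1) (a : ℝ) :
    IsClassicalNSSolutionOn univ ν (fun _ => (0 : (UnitAddTorus (Fin 3)) → (EuclideanSpace ℝ (Fin 3)))) (decayState n a)
      (fun _ => (fun _ : (UnitAddTorus (Fin 2)) => (0 : ℝ)) ∘ planarProj) := by
  have hV : IsSmoothSpaceTimeOn univ (fun _ : ℝ => (0 : (UnitAddTorus (Fin 2)) → (EuclideanSpace ℝ (Fin 2)))) := isSmoothSpaceTimeOn_const isSmooth_zero₂ _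
  have hφ : IsSmoothSpaceTimeOn univ (fun _ : ℝ => fun _ : (UnitAddTorus (Fin 2)) => (0 : ℝ)) :=
    isSmoothSpaceTimeOn_const (isSmooth_const (0 : ℝ)) _
  have hcl := isClassicalNSSolutionOn_twoHalf uniqueDiffOn_univ ν hV (isSmoothSpaceTimeOn_decayProfile n a) hφ
    (fun _ _ x => by simp [Torus.divergence, Torus.partialDeriv, Torus.lineDeriv])
  rw [twoHalfForce_decay n hν a] at hcl
  exact hcl

/-- **Free decay is a global Leray–Hopf solution for the zero force** from the datum `shear n a`. [folklore] -/
theorem isGlobalLerayHopf_decay (n : ℕ) {ν : ℝ} (hν : ν * ((n : ℝ) + 1) ^ 2 = 1) (a : ℝ) :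
    IsGlobalLerayHopf ν (fun _ => (0 : (UnitAddTorus (Fin 3)) → (EuclideanSpace ℝ (Fin 3)))) (shear n a) (decayState n a) := by
  have h := (isClassicalNSSolutionOn_decay n hν a).isGlobalLerayHopf
  rwa [decayState_eq, neg_mul, mul_zero, neg_zero, Real.exp_zero, one_mul] at h

/-- The decaying shear has mean energy at most `a²/2` (its slices have energy `a² e^{-8π²t}/2 ≤ a²/2` for `t > 0`;
in fact the mean energy is `0`). [folklore] -/
theorem meanEnergy_decayState_le (n : ℕ) (a : ℝ) : meanEnergy (decayState n a) ≤ a ^ 2 / 2 := by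
  rw [meanEnergy_eq_longTimeAvgSup]
  refine Literature.Barriers.AnomalousDissipation.longTimeAvgSup_le_of_forall_le
    (fun t _ => integral_nonneg fun _ => sq_nonneg _) fun t ht => ?_
  rw [decayState_eq, integral_norm_sq_shear]
  have h1 : Real.exp (-decayRate * t) ≤ 1 := by
    rw [Real.exp_le_one_iff]
    have : 0 < decayRate := by unfold decayRate; positivity
    nlinarith
  have h0 : 0 < Real.exp (-decayRate * t) := Real.exp_pos _
  have h2 : (Real.exp (-decayRate * t) * a) ^ 2 ≤ a ^ 2 := by
    rw [mul_pow]
    nlinarith [sq_nonneg a, mul_le_one₀ h1 h0.le h1]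
  linarith

/-- **The instantaneous dissipation of the free decay is level-independent**: with `ν(n+1)² = 1`,
`ν‖∇u(t)‖² = 2π² a² e^{-8π²t}` at every time. [folklore] -/
theorem dissipation_decayState (n : ℕ) {ν : ℝ} (hν : ν * ((n : ℝ) + 1) ^ 2 = 1) (a t : ℝ) :
    ν * (eGradNormSq (decayState n a t)).toReal = 2 * Real.pi ^ 2 * a ^ 2 * Real.exp (-decayRate * t) ^ 2 := by
  rw [decayState_eq, toReal_eGradNormSq_shear]
  linear_combination (2 * Real.pi ^ 2 * a ^ 2 * Real.exp (-decayRate * t) ^ 2) * hν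

/-- `TwohalfdNeg` with the conclusion STRENGTHENED from the long-time mean to a fixed positive time:
`∀ t > 0, ν_j ‖∇u_j(t)‖² → 0` (hypotheses verbatim, energy ceiling included). -/
def TwohalfdNegPointwise : Prop :=
  ∀ f : (UnitAddTorus (Fin 3)) → (EuclideanSpace ℝ (Fin 3)), (∀ (s : UnitAddCircle) (x : (UnitAddTorus (Fin 3))), f (x + Pi.single (2 : Fin 3) s) = f x) →
    IsSmooth f → IsDivFree f → HasZeroMean f →
    ∀ (ν : ℕ → ℝ) (u₀ : ℕ → (UnitAddTorus (Fin 3)) → (EuclideanSpace ℝ (Fin 3))) (u : ℕ → ℝ → (UnitAddTorus (Fin 3)) → (EuclideanSpace ℝ (Fin 3))),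
      (∀ j, 0 < ν j) → Tendsto ν atTop (𝓝 0) →
      (∀ j, IsGlobalLerayHopf (ν j) (fun _ => f) (u₀ j) (u j)) →
      (∀ j (t : ℝ) (s : UnitAddCircle) (x : (UnitAddTorus (Fin 3))), u j t (x + Pi.single (2 : Fin 3) s) = u j t x) →
      (∃ E : ℝ, ∀ j, meanEnergy (u j) ≤ E) →
      ∀ t : ℝ, 0 < t → Tendsto (fun j => ν j * (eGradNormSq (u j t)).toReal) atTop (𝓝 0)

/-- **NO FIXED-TIME VERSION OF THE CRUX HOLDS — even for the ZERO force.**  Witness: `f = 0`, `ν_j = (j+1)⁻²`, data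
`u₀_j = (0,0,cos(2π(j+1)x₀))` (bounded in `L²`, concentrating at the dissipative scale `|k| = j+1 = ν_j^{-1/2}`) and
the free decay `u_j(t) = e^{-4π²t} u₀_j` (exact: `ν_j(j+1)² = 1`; global Leray–Hopf, `x₃`-invariant): mean energy
`≤ 1/2` (indeed `0`), long-time mean dissipation `0` (consistent with the crux), but at every fixed time `t` the
dissipation is `ν_j‖∇u_j(t)‖² = 2π² e^{-8π²t}`, independent of `j` and positive.  The same family makes every
finite-window mean `T⁻¹∫₀ᵀ ν_j‖∇u_j‖² = (1 - e^{-8π²T})/(4T)` level-independent.  Reading for provers: the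
long-time average in `meanDissipation` is ESSENTIAL — the data `u₀_j` are only `L²`-bounded and may depend on `j`
adversarially, so any argument must either let `T → ∞` before `j → ∞` or pay for `‖u₀_j‖²/T`; windowed reductions
(cf. the crux-idea cards' finite-window lemmas) must carry that initial-energy term explicitly. [folklore] -/
theorem twohalfdNeg_false_pointwise : ¬ TwohalfdNegPointwise := by
  intro h
  have hν : ∀ j : ℕ, (0 : ℝ) < (1 / ((j : ℝ) + 1)) ^ 2 := fun j => by positivity
  have hν0 : Tendsto (fun j : ℕ => (1 / ((j : ℝ) + 1)) ^ 2) atTop (𝓝 0) := by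
    simpa using (tendsto_one_div_add_atTop_nhds_zero_nat (𝕜 := ℝ)).pow 2
  have hν1 : ∀ j : ℕ, (1 / ((j : ℝ) + 1)) ^ 2 * ((j : ℝ) + 1) ^ 2 = 1 := fun j => by
    have hj : (j : ℝ) + 1 ≠ 0 := by positivity
    field_simp
  have hsm : IsSmooth (0 : (UnitAddTorus (Fin 3)) → (EuclideanSpace ℝ (Fin 3))) := isSmooth_const (0 : (EuclideanSpace ℝ (Fin 3)))
  have hdf : IsDivFree (0 : (UnitAddTorus (Fin 3)) → (EuclideanSpace ℝ (Fin 3))) := fun x => by simp [Torus.divergence, Torus.partialDeriv, Torus.lineDeriv]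
  have hzm : HasZeroMean (0 : (UnitAddTorus (Fin 3)) → (EuclideanSpace ℝ (Fin 3))) := by simp [HasZeroMean]
  have hinv : ∀ j (t : ℝ) (s : UnitAddCircle) (x : (UnitAddTorus (Fin 3))), decayState j 1 t (x + Pi.single (2 : Fin 3) s) = decayState j 1 t x :=
    fun j t s x => by rw [decayState_eq]; exact shear_add_single j _ s x
  have ht := h 0 (fun _ _ => rfl) hsm hdf hzm (fun j => (1 / ((j : ℝ) + 1)) ^ 2) (fun j => shear j 1)
    (fun j => decayState j 1) hν hν0 (fun j => isGlobalLerayHopf_decay j (hν1 j) 1) hinv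
    ⟨1 ^ 2 / 2, fun j => meanEnergy_decayState_le j 1⟩ 1 one_pos
  refine not_tendsto_zero_of_le (c := 2 * Real.pi ^ 2 * 1 ^ 2 * Real.exp (-decayRate * 1) ^ 2) (by positivity)
    (fun j => (dissipation_decayState j (hν1 j) 1 1).ge) ht

end Decay

end Summit.AnomalousDissipation.AnomalousDissipation.Theorems.TwohalfdNeg.Negative

end
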